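import Literature.NumberTheory.EllipticCurves.GreenbergSelmer
import HarnessLib

/-!
# The fine (strict everywhere) Selmer group `Sel₀(K_∞, E[p^∞])` over a `ℤ_p`-extension and its
# Pontryagin dual `X₀(E/K_∞)` as a `Λ`-module — the right-hand side of Kato's main conjecture
# WITHOUT `p`-adic `L`-functions (draft definitions; cell `bsd-uniform`, track U3, seat u3-p2)

HONEST FRAMING: DEFINITIONS and unfolding lemmas only; nothing is asserted. This is the first half of the
object that O6's definition request D-O6-2 asks for (Kato's main conjecture at `(W, p)` in
fine-Selmer form, Kato 2004 Conj. 12.10 = Kim AJM 148 Conj. 1.3 = Kim–Pollack 2025 Conj. 3.17: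
`char_Λ(H¹_Iw(ℚ,T)/Λ·z^{Kato}) = char_Λ(Sel₀(ℚ_∞,E[p^∞])^∨)`); the left-hand side (`H¹_Iw` and
Kato's zeta element) is a separate file.

* `GreenbergSelmer.fineLocalDatum M v` — the ordinary local datum `M⁺_v = 0` at `v`; with it
  Greenberg's STRICT local condition at `v` ("replace `I_v` by `D_v`", Greenberg 1989 p. 98) is
  "the restriction to `H¹(L_w, M)` vanishes", i.e. LOCALLY TRIVIAL at `w ∣ v`.
* `GreenbergSelmer.fineData M p`, `fineSelmerInfty κ M` := `strictSelmerInfty κ M (fineData M p)` —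
  the classes in `H¹(K_∞, M)` locally trivial at EVERY place of `K_∞` (finite `v ∤ p`: `awayKer`;
  infinite: `infKer`; `v ∣ p`: the strict kernel for `M⁺ = 0`). For `K = ℚ`, `M = E[p^∞]` this is
  Kim's `p`-strict ("fine") Selmer group `Sel₀(ℚ_∞, E[p^∞])` (Kim, AJM 148 §1.2.4, arXiv:2203.12159v4
  p0005 L50: "the `p`-strict (“fine”) Selmer group of `E[p^∞]` over `ℚ_∞`"; Coates–Sujatha's
  `R(E/ℚ_∞)`), since at `w ∤ p` the Kummer condition over `K_∞` is "locally trivial"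
  (`E(K_{∞,w}) ⊗ ℚ_p/ℤ_p = 0`).
* `WeierstrassCurve.fineSelmerInfty W κ` — the case `M = W.geomPrimaryTorsion p`.
* `WeierstrassCurve.FineSelmerDualData W κ γ` — the Pontryagin dual `X₀ = Hom(Sel₀(K_∞), ℚ/ℤ)` as an
  abstract `Λ = ℤ_p⟦T⟧`-module with `T` acting as `γ − 1` — EXACTLY the hypothesis-structure pattern
  of `WeierstrassCurve.SelmerDualData` (file `IwasawaSelmer`, part (d)) with `Sel` replaced by `Sel₀`;
  `charIdeal`.

References: R. Greenberg, Adv. Stud. Pure Math. 17 (1989) p. 98 [Greenberg1989]; C.-H. Kim, Amer. J.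
Math. 148 (2026) §1.2.4, Conj. 1.3 [Kim2022StructureSelmer]; K. Kato, Astérisque 295 (2004) Conj. 12.10
(p. 224) [Kato2004Asterisque]; J. Coates, R. Sujatha, Math. Ann. 331 (2005) §3 [CoatesSujatha2005];
B. Mazur, Invent. Math. 18 (1972) §6 [Mazur1972].
-/

noncomputable section

open scoped Classical

open NumberField IsDedekindDomain Field
open Literature.NumberTheory.GaloisRepresentations

universe u

namespace Literature.NumberTheory.EllipticCurves.GreenbergSelmer

variable {K : Type u} [Field K] [NumberField K]

section Fine

variable (M : Type u) [AddCommGroup M] [DistribMulAction (absoluteGaloisGroup K) M]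

/-- The ordinary local datum `M⁺_v = 0` at the finite place `v`: Greenberg's strict condition for it
is "locally trivial at the place above `v`". [cite: Greenberg1989, §1 p. 98 (4) and the 'strict' variant] -/
def fineLocalDatum (v : HeightOneSpectrum (𝓞 K)) : LocalDatum K M v where
  plus := ⊥
  smul_mem := fun σ m hm ↦ by
    rw [AddSubgroup.mem_bot] at hm ⊢
    rw [hm, smul_zero]

/-- Unfolding: the plus part of the fine datum is `0`. [cite: Greenberg1989, §1 p. 98] -/
@[simp] theorem fineLocalDatum_plus (v : HeightOneSpectrum (𝓞 K)) :
    (fineLocalDatum M v).plus = ⊥ := rfl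

/-- The fine data above `p`: `M⁺_v = 0` at every `v ∣ p`. [cite: Greenberg1989, §1 p. 98] -/
def fineData (p : ℕ) : Data K M p := fun v _ ↦ fineLocalDatum M v

variable [TopologicalSpace M] [DiscreteTopology M] {p : ℕ} [Fact p.Prime] (κ : ZpExtension K p)

/-- **The fine Selmer group `Sel₀(K_∞, M) ⊆ H¹(K_∞, M)`** over the top of the `ℤ_p`-extension `κ`:
Greenberg's STRICT Selmer group for the data `M⁺_v = 0` (`v ∣ p`) — the classes locally trivial at
every place of `K_∞`. For `K = ℚ`, `M = E[p^∞]`: Kim's `p`-strict ("fine") Selmer group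
`Sel₀(ℚ_∞, E[p^∞])`. [cite: Kim2022StructureSelmer, §1.2.4 (arXiv v4 p0005 L50) and Conj. 1.3]
[cite: Greenberg1989, §1 p. 98] -/
def fineSelmerInfty : AddSubgroup (subgroupH1 κ.kerSubgroup M) :=
  strictSelmerInfty κ M (fineData M p)

/-- `Sel₀(K_∞, M)` is Greenberg's strict Selmer group of the fine data (definitional).
[cite: Greenberg1989, §1 p. 98] -/
theorem fineSelmerInfty_eq : fineSelmerInfty M κ = strictSelmerInfty κ M (fineData M p) := rfl

/-- `Sel₀(K_∞, M) ≤ Sel(K_∞, M)` (Greenberg's Selmer group of the same data).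
[cite: Greenberg1989, §1 p. 98] -/
theorem fineSelmerInfty_le_selmerInfty : fineSelmerInfty M κ ≤ selmerInfty κ M (fineData M p) :=
  strictSelmerInfty_le κ M _

/-- `Sel₀(K_∞, M)` is stable under the conjugation action of `Γ_K` (so `Γ = Gal(K_∞/K)` acts and the
dual is a `Λ`-module). [cite: Greenberg1989, §1 p. 98] -/
theorem conjH1_mem_fineSelmerInfty (γ : absoluteGaloisGroup K) {c : subgroupH1 κ.kerSubgroup M}
    (hc : c ∈ fineSelmerInfty M κ) : conjH1 κ.kerSubgroup M γ c ∈ fineSelmerInfty M κ :=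
  conjH1_mem_strictSelmerGroupOver γ hc

end Fine

end Literature.NumberTheory.EllipticCurves.GreenbergSelmer

namespace WeierstrassCurve

open Literature.NumberTheory.EllipticCurves Literature.NumberTheory.EllipticCurves.GreenbergSelmer

variable {K : Type u} [Field K] [NumberField K] (W : WeierstrassCurve K) {p : ℕ} [Fact p.Prime]
  (κ : ZpExtension K p) (γ : Field.absoluteGaloisGroup K)

/-- **`Sel₀(K_∞, E[p^∞])`**: the fine Selmer group of the `p`-primary torsion of `W` over the top of the
`ℤ_p`-extension `κ` (`GreenbergSelmer.fineSelmerInfty` for `M = W.geomPrimaryTorsion p`), inside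
`H¹(K_∞, E[p^∞]) = W.subgroupH1 p κ.kerSubgroup`. [cite: Kim2022StructureSelmer, §1.2.4 and Conj. 1.3]
[cite: Greenberg1989, §1 p. 98] -/
def fineSelmerInfty : AddSubgroup (W.subgroupH1 p κ.kerSubgroup) :=
  GreenbergSelmer.fineSelmerInfty (W.geomPrimaryTorsion p) κ

/-- `Sel₀(K_∞, E[p^∞])` is stable under `conj_γ`. [cite: Greenberg1989, §1 p. 98] -/
theorem conjH1_mem_fineSelmerInfty {s : W.subgroupH1 p κ.kerSubgroup} (hs : s ∈ W.fineSelmerInfty κ) :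
    W.conjH1 p κ.kerSubgroup γ s ∈ W.fineSelmerInfty κ :=
  GreenbergSelmer.conjH1_mem_fineSelmerInfty (W.geomPrimaryTorsion p) κ γ hs

/-- **Pontryagin-dual data for `Sel₀(K_∞, E[p^∞])`** (hypothesis structure, the exact analogue of
`WeierstrassCurve.SelmerDualData` for the FINE Selmer group): the Iwasawa module
`X₀ = X₀(E/K_∞) = Hom(Sel₀(K_∞, E[p^∞]), ℚ_p/ℤ_p)` as an abstract `Λ = ℤ_p⟦T⟧`-module `X` with
`toDual : X ≃ Hom(Sel₀, ℚ/ℤ)` (`bijective`), `T` acting as `γ − 1` (`toDual_T_smul`) and constants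
`c ∈ ℤ_p` acting on `p^k`-torsion classes through `ℤ_p → ℤ/p^k` (`toDual_C_smul`). The
`Λ`-characteristic ideal of `X₀` is the right-hand side of Kato's main conjecture without `p`-adic
`L`-functions. [cite: Kato2004Asterisque, Conj. 12.10 (p. 224)] [cite: Kim2022StructureSelmer, Conj. 1.3]
[cite: Mazur1972, §6] -/
structure FineSelmerDualData where
  /-- The underlying type of the Iwasawa module `X₀(E/K_∞)`. -/
  X : Type u
  /-- `X₀` is an abelian group. -/
  [addCommGroup : AddCommGroup X]
  /-- `X₀` is a `Λ = ℤ_p⟦T⟧`-module. -/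
  [module : Module (IwasawaAlgebra p) X]
  /-- The identification of `X₀` with the character group `Hom(Sel₀(K_∞), ℚ/ℤ)`. -/
  toDual : X →+ (W.fineSelmerInfty κ →+ AddCircle (1 : ℚ))
  /-- `toDual` is a group isomorphism. -/
  bijective : Function.Bijective toDual
  /-- `T` acts as `γ - 1`: `(T·x)(s) = x(conj_γ s) - x(s)`. -/
  toDual_T_smul : ∀ (x : X) (s : W.fineSelmerInfty κ),
    toDual ((PowerSeries.X : IwasawaAlgebra p) • x) s =
      toDual x ⟨W.conjH1 p κ.kerSubgroup γ s, W.conjH1_mem_fineSelmerInfty κ γ s.2⟩ - toDual x s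
  /-- Constants `c ∈ ℤ_p` act on `p^k`-torsion classes through `ℤ_p → ℤ/p^k`. -/
  toDual_C_smul : ∀ (c : ℤ_[p]) (x : X) (s : W.fineSelmerInfty κ) (k : ℕ), (p ^ k) • s = 0 →
    toDual (PowerSeries.C c • x) s = (PadicInt.toZModPow k c).val • toDual x s

attribute [instance] FineSelmerDualData.addCommGroup FineSelmerDualData.module

namespace FineSelmerDualData

variable {W κ γ} (D : W.FineSelmerDualData κ γ)

/-- The **characteristic ideal** `char_Λ X₀(E/K_∞) ⊆ Λ` of the dual fine Selmer group — the
right-hand side of Kato's main conjecture without `p`-adic `L`-functions.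
[cite: Kato2004Asterisque, Conj. 12.10 (p. 224)] [cite: Kim2022StructureSelmer, Conj. 1.3] -/
def charIdeal : Ideal (IwasawaAlgebra p) :=
  Literature.NumberTheory.EllipticCurves.Module.charIdeal (IwasawaAlgebra p) D.X

end FineSelmerDualData

end WeierstrassCurve

end
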